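import Summits.AtomisticToContinuum.Crystallization.Theorems.ChartedZeroExcessLayeredLatticeLiouvilleXM

/-!
# Zero-excess layered lattice Liouville — part XN (lens-2 g59, node «SBGlueC4b»): the scalar PROFILE STEP of the tower

Critic rows 1133/1135 (C4), leaf (2) `SubWindowBudgetGlueBPG` of `stmt-AtomisticToContinuum-26636`.  Pure real arithmetic over the constants record
`SBK` of part XM.  The count-normalised recursion delivered by XK (`sbModeStep`: mode size `mM²·#B_{n'} ≤ CL(2+2CLtC²)(2E_n + 2cE)`, excess
`≤ 2cE + 2(CL tC² #B_{n'}/#B_n)(2E_n + 2cE)`; (E4): `E' ≤ 2·excess + 54L²·#B_{n'}`, `L = CR·mM² + ε·mM`), fed with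

* the profile bound of the current level `E_n ≤ p ℓ·#B_n` (`p ℓ = P₀θ₁^ℓ + G₀/n_ℓ²`, XM),
* the HISTORY bound of the comparison energy `Em ≤ Rhist·(2pπ + 54Δ²)·#B_{n'}` (parent profile value `pπ` and recent drift `Δ²`, both below
  `p(ℓ+1)/θ₁^{k₀+1}` up to the factor `4k₀²Cm`),
* the FAR-FIELD bound `F ≤ (1000C₁/(δ³tC³))·Θ ℓ·#B_{n'}/n_ℓ²` (`Θ ℓ = Θa + Θb/n_ℓ²`),

closes the bootstrap: XN.1 `cE ≤ cEb·#B_{n'}` with the per-count error `cEb` (XN.0) and `(4+8CL)·cEb ≤ p(ℓ+1)/4` (history share `≤ p/8` by `OK.hγ`, far share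
`≤ p/8` by `OK.hfarA/B`); XN.2 the mode size `mM² ≤ Cm·p ℓ`; XN.3 the correction `54L² ≤ p(ℓ+1)/8`, `L ≤ mM ≤ m₀`; XN.4 ★ `E' ≤ p(ℓ+1)·#B_{n'}` — the main term
uses ONLY the contraction hypothesis `θ₀ = 8CL·tC² ≤ 1/8` with the EXACT count ratio (`(CL tC² #B_{n'}/#B_n)·p ℓ·#B_n = CL tC²·p ℓ·#B_{n'}`: no window factor);
XN.5 `profile_step` packages the four conclusions for the step lemma of part XP.
-/

noncomputable section

open scoped BigOperators
open Set Function Metric Finset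

namespace Summit.AtomisticToContinuum.Crystallization.Theorems.ChartedZeroExcessLayeredLatticeLiouville

namespace SBK

variable {K : SBK}

/-! ### XN.0  The per-count comparison error -/

/-- the per-count comparison error at level `ℓ` with parent profile value `pπ` and recent drift `Δ`:
`cEb = (3/κ₁²)·((dA²εf² + (½CT·δs·dAϱ)²)·Rhist·(2pπ + 54Δ²) + dA·AT²·(1000C₁/(δ³tC³))·Θ ℓ/n ℓ²)`. [this file, g59] -/
def cEb (K : SBK) (ℓ : ℕ) (pπ Δ : ℝ) : ℝ :=
  3 / K.κ₁ ^ 2 * ((K.dA ^ 2 * K.εf ^ 2 + (1 / 2 * K.CT * K.δs * K.dAϱ) ^ 2) * (K.Rhist * (2 * pπ + 54 * Δ ^ 2)) +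
    K.dA * K.AT ^ 2 * (1000 * K.C₁ / (K.δ ^ 3 * K.tC ^ 3) * K.Θ ℓ / K.n ℓ ^ 2))

/-- `Θ_nonneg` (docstring added by the landing lane; see the module docstring). [formal bookkeeping] -/
theorem Θ_nonneg (hK : K.OK) (ℓ : ℕ) : 0 ≤ K.Θ ℓ := by
  unfold Θ; have := hK.hΘa; have := hK.hΘb; have := n_pos hK ℓ; positivity

/-- `cEb_nonneg` (docstring added by the landing lane; see the module docstring). [formal bookkeeping] -/
theorem cEb_nonneg (hK : K.OK) (ℓ : ℕ) {pπ Δ : ℝ} (hpπ : 0 ≤ pπ) : 0 ≤ K.cEb ℓ pπ Δ := by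
  unfold cEb
  have := hK.hAT; have := hK.hδ; have := C₁_pos hK; have := Θ_nonneg hK ℓ; have := hK.htC; have := Rhist_pos hK
  have : 0 ≤ K.dA := dictA_nonneg _ _
  positivity

/-! ### XN.1  The comparison error against the history and far-field bounds -/

/-- `cE ≤ cEb·#B_{n'}`: XK's `compErr` bound with the history bound on `Em` and the far-field bound on `F` substituted. -/
theorem cE_le_cEb (hK : K.OK) {ℓ : ℕ} {Em cE F Nn1 pπ Δ : ℝ}
    (hcE : cE ≤ 3 * (K.dA ^ 2 * K.εf ^ 2 * Em + K.dA * K.AT ^ 2 * F + (1 / 2 * K.CT * K.δs * K.dAϱ) ^ 2 * Em) / K.κ₁ ^ 2)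
    (hEmb : Em ≤ K.Rhist * (2 * pπ + 54 * Δ ^ 2) * Nn1)
    (hFb : F ≤ 1000 * K.C₁ / (K.δ ^ 3 * K.tC ^ 3) * K.Θ ℓ * Nn1 / K.n ℓ ^ 2) :
    cE ≤ K.cEb ℓ pπ Δ * Nn1 := by
  have hdA : 0 ≤ K.dA := dictA_nonneg _ _
  have hκ₁ := hK.hκ₁
  have h4 : cE ≤ 3 * (K.dA ^ 2 * K.εf ^ 2 * (K.Rhist * (2 * pπ + 54 * Δ ^ 2) * Nn1) + K.dA * K.AT ^ 2 *
      (1000 * K.C₁ / (K.δ ^ 3 * K.tC ^ 3) * K.Θ ℓ * Nn1 / K.n ℓ ^ 2) + (1 / 2 * K.CT * K.δs * K.dAϱ) ^ 2 *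
      (K.Rhist * (2 * pπ + 54 * Δ ^ 2) * Nn1)) / K.κ₁ ^ 2 := by
    refine hcE.trans ?_
    gcongr
  refine h4.trans (le_of_eq ?_)
  unfold cEb; ring

/-- `(4+8CL)·cEb ≤ p(ℓ+1)/4`: the history share is `≤ p(ℓ+1)/8` by `OK.hγ` (`pπ`, `Δ²` below `p(ℓ+1)/θ₁^{k₀+1}`), the far share is `≤ p(ℓ+1)/8` by `OK.hfarA/B`
(`G₀/n(ℓ+1)² ≤ p(ℓ+1)`, `n(ℓ+1) = tC·n ℓ`, `n ℓ ≥ nlo`). [this file, g59] -/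
theorem cEb_le (hK : K.OK) {ℓ : ℕ} (hℓ : K.nlo ≤ K.n (ℓ + 1)) {pπ Δ : ℝ}
    (hpπ : pπ ≤ K.p (ℓ + 1) / K.θ₁ ^ (K.k₀ + 1)) (hΔ : Δ ^ 2 ≤ 4 * (K.k₀ : ℝ) ^ 2 * K.Cm * (K.p (ℓ + 1) / K.θ₁ ^ (K.k₀ + 1))) :
    (4 + 8 * K.CL) * K.cEb ℓ pπ Δ ≤ K.p (ℓ + 1) / 4 := by
  have hCL := hK.hCL
  have htC := hK.htC
  have hκ₁ := hK.hκ₁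
  have hθ := θ₁_pos hK
  have hP : 0 ≤ K.p (ℓ + 1) := p_nonneg hK _
  have hnℓ : K.nlo ≤ K.n ℓ := hℓ.trans (n_succ_le hK ℓ)
  have hn := n_pos hK ℓ
  have hdA : 0 ≤ K.dA := dictA_nonneg _ _
  have hCm := Cm_pos hK
  set P := K.p (ℓ + 1) with hPdef
  set Q := P / K.θ₁ ^ (K.k₀ + 1) with hQ
  have hQ0 : 0 ≤ Q := by positivity
  -- history share
  have hhistP : (4 + 8 * K.CL) * (3 / K.κ₁ ^ 2 * ((K.dA ^ 2 * K.εf ^ 2 + (1 / 2 * K.CT * K.δs * K.dAϱ) ^ 2) *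
      (K.Rhist * (2 * pπ + 54 * Δ ^ 2)))) ≤ P / 8 := by
    have e : (4 + 8 * K.CL) * (3 / K.κ₁ ^ 2 * ((K.dA ^ 2 * K.εf ^ 2 + (1 / 2 * K.CT * K.δs * K.dAϱ) ^ 2) *
        (K.Rhist * (2 * pπ + 54 * Δ ^ 2)))) = K.γ * K.Rhist * (2 * pπ + 54 * Δ ^ 2) := by unfold SBK.γ; ring
    rw [e]
    have h1 : 2 * pπ + 54 * Δ ^ 2 ≤ (2 + 216 * (K.k₀ : ℝ) ^ 2 * K.Cm) * Q := by
      have : (2 + 216 * (K.k₀ : ℝ) ^ 2 * K.Cm) * Q = 2 * Q + 54 * (4 * (K.k₀ : ℝ) ^ 2 * K.Cm * Q) := by ring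
      rw [this]; linarith
    have hγ0 : 0 ≤ K.γ := by unfold SBK.γ; positivity
    have hRh := (Rhist_pos hK).le
    calc K.γ * K.Rhist * (2 * pπ + 54 * Δ ^ 2) ≤ K.γ * K.Rhist * ((2 + 216 * (K.k₀ : ℝ) ^ 2 * K.Cm) * Q) :=
          mul_le_mul_of_nonneg_left h1 (by positivity)
      _ = K.γ * K.Rhist * (2 + 216 * (K.k₀ : ℝ) ^ 2 * K.Cm) * Q := by ring
      _ ≤ K.θ₁ ^ (K.k₀ + 1) / 8 * Q := mul_le_mul_of_nonneg_right hK.hγ hQ0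
      _ = P / 8 := by rw [hQ]; field_simp
  -- far-field share
  have hfarP : (4 + 8 * K.CL) * (3 / K.κ₁ ^ 2 * (K.dA * K.AT ^ 2 * (1000 * K.C₁ / (K.δ ^ 3 * K.tC ^ 3) * K.Θ ℓ / K.n ℓ ^ 2))) ≤ P / 8 := by
    have hδ := hK.hδ
    have hC₁ := C₁_pos hK
    have hG₁ : 0 ≤ K.G₁ := by unfold SBK.G₁; have := hK.hAT; positivity
    have hn2 : 0 < K.n ℓ ^ 2 := by positivity
    have e : (4 + 8 * K.CL) * (3 / K.κ₁ ^ 2 * (K.dA * K.AT ^ 2 * (1000 * K.C₁ / (K.δ ^ 3 * K.tC ^ 3) * K.Θ ℓ / K.n ℓ ^ 2))) =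
        K.G₁ * K.Θ ℓ / K.n ℓ ^ 2 := by
      unfold SBK.G₁; ring
    rw [e]
    have hΘ : K.G₁ * K.Θ ℓ ≤ K.G₀ / (8 * K.tC ^ 2) := by
      unfold SBK.Θ
      have hA : K.G₁ * K.Θa ≤ K.G₀ / (16 * K.tC ^ 2) := by
        rw [le_div_iff₀ (by positivity)]; linarith [hK.hfarA]
      have hB : K.G₁ * (K.Θb / K.n ℓ ^ 2) ≤ K.G₀ / (16 * K.tC ^ 2) := by
        rw [le_div_iff₀ (by positivity)]
        have h2 : K.Θb / K.n ℓ ^ 2 ≤ K.Θb / K.nlo ^ 2 :=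
          div_le_div_of_nonneg_left hK.hΘb (by have := nlo_pos hK; positivity) (pow_le_pow_left₀ (nlo_pos hK).le hnℓ 2)
        have h3 : K.G₁ * (K.Θb / K.nlo ^ 2) * (16 * K.tC ^ 2) ≤ K.G₀ := by
          have h := hK.hfarB
          have hnlo2 : 0 < K.nlo ^ 2 := by have := nlo_pos hK; positivity
          have e' : K.G₁ * (K.Θb / K.nlo ^ 2) * (16 * K.tC ^ 2) = (16 * K.tC ^ 2 * K.G₁ * K.Θb) / K.nlo ^ 2 := by ring
          rw [e', div_le_iff₀ hnlo2]; exact h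
        calc K.G₁ * (K.Θb / K.n ℓ ^ 2) * (16 * K.tC ^ 2) ≤ K.G₁ * (K.Θb / K.nlo ^ 2) * (16 * K.tC ^ 2) := by gcongr
          _ ≤ K.G₀ := h3
      have e' : K.G₀ / (16 * K.tC ^ 2) + K.G₀ / (16 * K.tC ^ 2) = K.G₀ / (8 * K.tC ^ 2) := by ring
      rw [mul_add]; linarith
    have hGn : K.G₀ / K.n (ℓ + 1) ^ 2 ≤ P := by
      rw [hPdef]; unfold SBK.p
      have := hK.hP₀; have := pow_nonneg (θ₁_nonneg hK) (ℓ + 1); nlinarith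
    calc K.G₁ * K.Θ ℓ / K.n ℓ ^ 2 ≤ K.G₀ / (8 * K.tC ^ 2) / K.n ℓ ^ 2 := div_le_div_of_nonneg_right hΘ hn2.le
      _ = K.G₀ / K.n (ℓ + 1) ^ 2 / 8 := by rw [n_succ]; ring
      _ ≤ P / 8 := by linarith
  have e : (4 + 8 * K.CL) * K.cEb ℓ pπ Δ = (4 + 8 * K.CL) * (3 / K.κ₁ ^ 2 * ((K.dA ^ 2 * K.εf ^ 2 + (1 / 2 * K.CT * K.δs * K.dAϱ) ^ 2) *
      (K.Rhist * (2 * pπ + 54 * Δ ^ 2)))) +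
      (4 + 8 * K.CL) * (3 / K.κ₁ ^ 2 * (K.dA * K.AT ^ 2 * (1000 * K.C₁ / (K.δ ^ 3 * K.tC ^ 3) * K.Θ ℓ / K.n ℓ ^ 2))) := by
    unfold cEb; ring
  rw [e]; linarith

/-! ### XN.2  The mode size -/

/-- `mM² ≤ Cm·p ℓ` from XK's mode-size bound (`cEb` generic: any per-count error with `(4+8CL)cEb ≤ p(ℓ+1)/4`). [this file, g59] -/
theorem mode_size_le (hK : K.OK) {ℓ : ℕ} {En cE Nn Nn1 mM cEb : ℝ} (hNn1 : 0 < Nn1) (hN01 : Nn ≤ K.rN * Nn1)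
    (hEn0 : 0 ≤ En) (hcE0 : 0 ≤ cE)
    (hsize : mM ^ 2 * Nn1 ≤ K.CL * (2 + 2 * (K.CL * K.tC ^ 2)) * (2 * En + 2 * cE))
    (hEn : En ≤ K.p ℓ * Nn) (hcE' : cE ≤ cEb * Nn1) (hcEb0 : 0 ≤ cEb) (hcEbP : (4 + 8 * K.CL) * cEb ≤ K.p (ℓ + 1) / 4) :
    mM ^ 2 ≤ K.Cm * K.p ℓ := by
  have hCL := hK.hCL
  have htC := hK.htC
  have hp : 0 ≤ K.p ℓ := p_nonneg hK _
  have hPp : K.p (ℓ + 1) ≤ K.p ℓ / K.tC ^ 2 := p_succ_le hK ℓ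
  have hcEbp : 2 * cEb ≤ K.p ℓ / K.tC ^ 2 := by
    have : cEb ≤ (4 + 8 * K.CL) * cEb := le_mul_of_one_le_left hcEb0 (by linarith)
    linarith
  have h1 : K.CL * (2 + 2 * (K.CL * K.tC ^ 2)) ≤ K.CL * (2 + 2 * K.CL) := by
    have ht1 : K.tC ^ 2 ≤ 1 := pow_le_one₀ htC.le (tC_le_one hK)
    have h' : K.CL * K.tC ^ 2 ≤ K.CL := mul_le_of_le_one_right (by linarith) ht1
    have h'' := mul_le_mul_of_nonneg_left h' (by linarith : (0 : ℝ) ≤ K.CL)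
    nlinarith
  have h2 : 2 * En + 2 * cE ≤ (2 * K.rN * K.p ℓ + 2 * cEb) * Nn1 := by nlinarith [mul_le_mul_of_nonneg_left hN01 hp]
  have h0 : 0 ≤ 2 * En + 2 * cE := by positivity
  have h3 : mM ^ 2 * Nn1 ≤ (K.CL * (2 + 2 * K.CL) * (2 * K.rN * K.p ℓ + 2 * cEb)) * Nn1 := by
    have := hsize.trans ((mul_le_mul_of_nonneg_right h1 h0).trans (mul_le_mul_of_nonneg_left h2 (by positivity)))
    linarith
  have h4 : mM ^ 2 ≤ K.CL * (2 + 2 * K.CL) * (2 * K.rN * K.p ℓ + 2 * cEb) := le_of_mul_le_mul_right h3 hNn1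
  refine h4.trans ?_
  unfold SBK.Cm
  have h5 : 2 * K.rN * K.p ℓ + 2 * cEb ≤ (2 * K.rN + 1 / K.tC ^ 2) * K.p ℓ := by rw [add_mul, one_div_mul_eq_div]; linarith
  calc K.CL * (2 + 2 * K.CL) * (2 * K.rN * K.p ℓ + 2 * cEb) ≤ K.CL * (2 + 2 * K.CL) * ((2 * K.rN + 1 / K.tC ^ 2) * K.p ℓ) :=
        mul_le_mul_of_nonneg_left h5 (by positivity)
    _ = _ := by ring

/-! ### XN.3  The correction constant -/

/-- from `mM² ≤ Cm·p ℓ` on the tower: `54L² ≤ p(ℓ+1)/8` (`OK.hεs`, `OK.hCRs`), `L ≤ mM` (`OK.hLc`), `mM ≤ m₀` (`OK.hm₀s`), `mM ≤ √(Cm·p ℓ)`, where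
`L = CR·mM² + ε·mM` is the correction Lipschitz constant of (RC). [this file, g59] -/
theorem corr_le (hK : K.OK) {ℓ : ℕ} (hnℓ : K.nlo ≤ K.n ℓ) {mM : ℝ} (hmM : 0 ≤ mM) (hmM2 : mM ^ 2 ≤ K.Cm * K.p ℓ) :
    54 * (K.CR * mM ^ 2 + K.ε * mM) ^ 2 ≤ K.p (ℓ + 1) / 8 ∧ K.CR * mM ^ 2 + K.ε * mM ≤ mM ∧ mM ≤ K.m₀ ∧
      mM ≤ Real.sqrt (K.Cm * K.p ℓ) := by
  have hCm := Cm_pos hK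
  have hp : 0 ≤ K.p ℓ := p_nonneg hK _
  have hppmax : K.p ℓ ≤ K.pmax := p_le_pmax hK hnℓ
  have hmMs : mM ≤ Real.sqrt (K.Cm * K.p ℓ) := by
    rw [← Real.sqrt_sq hmM]; exact Real.sqrt_le_sqrt hmM2
  have hmMmax : mM ≤ Real.sqrt (K.Cm * K.pmax) := hmMs.trans (Real.sqrt_le_sqrt (mul_le_mul_of_nonneg_left hppmax hCm.le))
  have hmMm₀ : mM ≤ K.m₀ := by
    refine hmMmax.trans ?_
    rw [← Real.sqrt_sq hK.hm₀.le]; exact Real.sqrt_le_sqrt hK.hm₀s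
  have hLc1 : K.CR * mM + K.ε ≤ 1 := by
    have h := hK.hLc; have hCR := hK.hCR
    have : K.CR * mM ≤ K.CR * Real.sqrt (K.Cm * K.pmax) := mul_le_mul_of_nonneg_left hmMmax (by linarith)
    linarith
  have hLc : K.CR * mM ^ 2 + K.ε * mM ≤ mM := by
    have e : K.CR * mM ^ 2 + K.ε * mM = mM * (K.CR * mM + K.ε) := by ring
    rw [e]; exact mul_le_of_le_one_right hmM hLc1
  have hL2 : 54 * (K.CR * mM ^ 2 + K.ε * mM) ^ 2 ≤ K.p (ℓ + 1) / 8 := by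
    have hθp : K.θ₁ * K.p ℓ ≤ K.p (ℓ + 1) := p_succ_ge hK ℓ
    have hCR := hK.hCR
    have hε := hK.hε
    have h1 : (K.CR * mM ^ 2 + K.ε * mM) ^ 2 ≤ 2 * (K.CR ^ 2 * (mM ^ 2 * mM ^ 2)) + 2 * (K.ε ^ 2 * mM ^ 2) := by
      nlinarith [sq_nonneg (K.CR * mM ^ 2 - K.ε * mM)]
    have h2 : mM ^ 2 * mM ^ 2 ≤ (K.Cm * K.p ℓ) * (K.Cm * K.pmax) :=
      mul_le_mul hmM2 (hmM2.trans (mul_le_mul_of_nonneg_left hppmax hCm.le)) (by positivity) (by positivity)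
    have h3 : K.CR ^ 2 * (mM ^ 2 * mM ^ 2) ≤ (K.CR ^ 2 * K.Cm ^ 2 * K.pmax) * K.p ℓ := by
      have := mul_le_mul_of_nonneg_left h2 (sq_nonneg K.CR); nlinarith
    have h4 : K.ε ^ 2 * mM ^ 2 ≤ (K.ε ^ 2 * K.Cm) * K.p ℓ := by
      have := mul_le_mul_of_nonneg_left hmM2 (sq_nonneg K.ε); nlinarith
    have h5 : 1728 * ((K.CR ^ 2 * K.Cm ^ 2 * K.pmax) * K.p ℓ) ≤ K.θ₁ * K.p ℓ := by
      have := mul_le_mul_of_nonneg_right hK.hCRs hp; nlinarith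
    have h6 : 1728 * ((K.ε ^ 2 * K.Cm) * K.p ℓ) ≤ K.θ₁ * K.p ℓ := by
      have := mul_le_mul_of_nonneg_right hK.hεs hp; nlinarith
    nlinarith
  exact ⟨hL2, hLc, hmMm₀, hmMs⟩

/-! ### XN.4  The energy of the next iterate -/

/-- ★ `E' ≤ p(ℓ+1)·#B_{n'}`: main term `8CL·tC²·p ℓ = θ₀·p ℓ ≤ p(ℓ+1)/2` (EXACT count ratio), comparison `(4+8CL)·cEb ≤ p(ℓ+1)/4`, correction `54L² ≤ p(ℓ+1)/8`.
[this file, g59] -/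
theorem energy_le (hK : K.OK) {ℓ : ℕ} {En cE Nn Nn1 Eexc E' cEb Lc : ℝ} (hNn1 : 0 < Nn1) (hN10 : Nn1 ≤ Nn)
    (hexc : Eexc ≤ 2 * cE + 2 * (K.CL * K.tC ^ 2 * Nn1 / Nn) * (2 * En + 2 * cE))
    (hE' : E' ≤ 2 * Eexc + 54 * Lc ^ 2 * Nn1)
    (hEn : En ≤ K.p ℓ * Nn) (hcE' : cE ≤ cEb * Nn1) (hcEb0 : 0 ≤ cEb) (hcEbP : (4 + 8 * K.CL) * cEb ≤ K.p (ℓ + 1) / 4)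
    (hL2 : 54 * Lc ^ 2 ≤ K.p (ℓ + 1) / 8) :
    E' ≤ K.p (ℓ + 1) * Nn1 := by
  have hCL := hK.hCL
  have htC := hK.htC
  have hp : 0 ≤ K.p ℓ := p_nonneg hK _
  have hNn : 0 < Nn := lt_of_lt_of_le hNn1 hN10
  have hmain : K.θ₀ * K.p ℓ ≤ K.p (ℓ + 1) / 2 := θ₀_p_le hK ℓ
  have hratio : K.CL * K.tC ^ 2 * Nn1 / Nn ≤ K.CL * K.tC ^ 2 := by
    rw [div_le_iff₀ hNn]; exact mul_le_mul_of_nonneg_left hN10 (by positivity)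
  have hr0 : 0 ≤ K.CL * K.tC ^ 2 * Nn1 / Nn := by positivity
  have h1 : Eexc ≤ 2 * cEb * Nn1 + 2 * (K.CL * K.tC ^ 2 * Nn1 / Nn) * (2 * K.p ℓ * Nn + 2 * cEb * Nn1) := by
    have hα : 2 * En + 2 * cE ≤ 2 * K.p ℓ * Nn + 2 * cEb * Nn1 := by linarith
    have hβ := mul_le_mul_of_nonneg_left hα (by positivity : (0 : ℝ) ≤ 2 * (K.CL * K.tC ^ 2 * Nn1 / Nn))
    linarith
  have e1 : 2 * (K.CL * K.tC ^ 2 * Nn1 / Nn) * (2 * K.p ℓ * Nn) = 4 * (K.CL * K.tC ^ 2) * K.p ℓ * Nn1 := by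
    have hd : Nn / Nn = 1 := div_self hNn.ne'
    calc 2 * (K.CL * K.tC ^ 2 * Nn1 / Nn) * (2 * K.p ℓ * Nn) = 4 * (K.CL * K.tC ^ 2) * K.p ℓ * Nn1 * (Nn / Nn) := by ring
      _ = _ := by rw [hd, mul_one]
  have e2 : 2 * (K.CL * K.tC ^ 2 * Nn1 / Nn) * (2 * cEb * Nn1) ≤ 4 * (K.CL * K.tC ^ 2) * cEb * Nn1 := by
    have hcN : 0 ≤ cEb * Nn1 := mul_nonneg hcEb0 hNn1.le
    have h := mul_le_mul_of_nonneg_right hratio hcN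
    calc 2 * (K.CL * K.tC ^ 2 * Nn1 / Nn) * (2 * cEb * Nn1) = 4 * (K.CL * K.tC ^ 2 * Nn1 / Nn * (cEb * Nn1)) := by ring
      _ ≤ 4 * (K.CL * K.tC ^ 2 * (cEb * Nn1)) := by linarith
      _ = _ := by ring
  have h3 : Eexc ≤ (2 * cEb + 4 * (K.CL * K.tC ^ 2) * K.p ℓ + 4 * (K.CL * K.tC ^ 2) * cEb) * Nn1 :=
    calc Eexc ≤ 2 * cEb * Nn1 + 2 * (K.CL * K.tC ^ 2 * Nn1 / Nn) * (2 * K.p ℓ * Nn + 2 * cEb * Nn1) := h1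
      _ = 2 * cEb * Nn1 + 2 * (K.CL * K.tC ^ 2 * Nn1 / Nn) * (2 * K.p ℓ * Nn) +
            2 * (K.CL * K.tC ^ 2 * Nn1 / Nn) * (2 * cEb * Nn1) := by ring
      _ ≤ 2 * cEb * Nn1 + 4 * (K.CL * K.tC ^ 2) * K.p ℓ * Nn1 + 4 * (K.CL * K.tC ^ 2) * cEb * Nn1 := by rw [e1]; linarith
      _ = _ := by ring
  have h5 : 4 * cEb + 8 * (K.CL * K.tC ^ 2) * cEb ≤ (4 + 8 * K.CL) * cEb := by
    have ht1 : K.tC ^ 2 ≤ 1 := pow_le_one₀ htC.le (tC_le_one hK)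
    have h' : K.CL * K.tC ^ 2 ≤ K.CL := mul_le_of_le_one_right (by linarith) ht1
    have := mul_le_mul_of_nonneg_right h' hcEb0
    linarith
  have h6 : 8 * (K.CL * K.tC ^ 2) * K.p ℓ = K.θ₀ * K.p ℓ := by unfold SBK.θ₀; ring
  have hP : 0 ≤ K.p (ℓ + 1) := p_nonneg hK _
  have h7 : 4 * cEb + 8 * (K.CL * K.tC ^ 2) * K.p ℓ + 8 * (K.CL * K.tC ^ 2) * cEb + 54 * Lc ^ 2 ≤ K.p (ℓ + 1) := by linarith
  have h4 : E' ≤ (4 * cEb + 8 * (K.CL * K.tC ^ 2) * K.p ℓ + 8 * (K.CL * K.tC ^ 2) * cEb + 54 * Lc ^ 2) * Nn1 := by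
    have := mul_le_mul_of_nonneg_left h3 (by norm_num : (0 : ℝ) ≤ 2)
    linarith
  exact h4.trans (mul_le_mul_of_nonneg_right h7 hNn1.le)

/-! ### XN.5  The profile step -/

/-- ★★ **THE PROFILE STEP** — XN.1–XN.4 combined: at a level `ℓ` of the tower (`n(ℓ+1) ≥ nlo`), the outputs of XK's `sbModeStep` and of (E4), with the profile bound of level
`ℓ`, the history bound on the comparison energy and the far-field bound, give `mM² ≤ Cm·p ℓ`, `E' ≤ p(ℓ+1)·#B_{n(ℓ+1)}`, `L ≤ mM`, `mM ≤ m₀`, `mM ≤ √(Cm·p ℓ)`.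
[this file, g59] -/
theorem profile_step (hK : K.OK) {ℓ : ℕ} (hℓ : K.nlo ≤ K.n (ℓ + 1))
    {En Em cE F Nn Nn1 mM Eexc E' pπ Δ : ℝ} (hNn1 : 0 < Nn1) (hN10 : Nn1 ≤ Nn) (hN01 : Nn ≤ K.rN * Nn1)
    (hmM : 0 ≤ mM) (hEn0 : 0 ≤ En) (hcE0 : 0 ≤ cE)
    (hsize : mM ^ 2 * Nn1 ≤ K.CL * (2 + 2 * (K.CL * K.tC ^ 2)) * (2 * En + 2 * cE))
    (hexc : Eexc ≤ 2 * cE + 2 * (K.CL * K.tC ^ 2 * Nn1 / Nn) * (2 * En + 2 * cE))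
    (hE' : E' ≤ 2 * Eexc + 54 * (K.CR * mM ^ 2 + K.ε * mM) ^ 2 * Nn1)
    (hEn : En ≤ K.p ℓ * Nn)
    (hcE : cE ≤ 3 * (K.dA ^ 2 * K.εf ^ 2 * Em + K.dA * K.AT ^ 2 * F + (1 / 2 * K.CT * K.δs * K.dAϱ) ^ 2 * Em) / K.κ₁ ^ 2)
    (hEmb : Em ≤ K.Rhist * (2 * pπ + 54 * Δ ^ 2) * Nn1) (hpπ0 : 0 ≤ pπ) (hpπ : pπ ≤ K.p (ℓ + 1) / K.θ₁ ^ (K.k₀ + 1))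
    (hΔ : Δ ^ 2 ≤ 4 * (K.k₀ : ℝ) ^ 2 * K.Cm * (K.p (ℓ + 1) / K.θ₁ ^ (K.k₀ + 1)))
    (hFb : F ≤ 1000 * K.C₁ / (K.δ ^ 3 * K.tC ^ 3) * K.Θ ℓ * Nn1 / K.n ℓ ^ 2) :
    mM ^ 2 ≤ K.Cm * K.p ℓ ∧ E' ≤ K.p (ℓ + 1) * Nn1 ∧ K.CR * mM ^ 2 + K.ε * mM ≤ mM ∧ mM ≤ K.m₀ ∧
      mM ≤ Real.sqrt (K.Cm * K.p ℓ) := by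
  have hnℓ : K.nlo ≤ K.n ℓ := hℓ.trans (n_succ_le hK ℓ)
  have hcE' := cE_le_cEb hK hcE hEmb hFb
  have hcEb0 := cEb_nonneg hK ℓ (Δ := Δ) hpπ0
  have hcEbP := cEb_le hK hℓ hpπ hΔ
  have hmM2 := mode_size_le hK hNn1 hN01 hEn0 hcE0 hsize hEn hcE' hcEb0 hcEbP
  obtain ⟨hL2, hLc, hm₀, hms⟩ := corr_le hK hnℓ hmM hmM2
  exact ⟨hmM2, energy_le hK hNn1 hN10 hexc hE' hEn hcE' hcEb0 hcEbP hL2, hLc, hm₀, hms⟩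

end SBK

end Summit.AtomisticToContinuum.Crystallization.Theorems.ChartedZeroExcessLayeredLatticeLiouville

end
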